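import Summits.Ventures.PercRepro.SixFourResidueSmallCases
import Summits.Ventures.PercRepro.SixFourResidueGeneric
import Summits.Ventures.PercRepro.SixFourResidueTwoPointsD
import Summits.Ventures.PercRepro.SixFourResidueSmallG

/-!
# PercRepro — C-025 at `(6,4)`: THE `g ≤ 9` CLAUSE OF `SixFourResidue` AT `t = 4` (p2, gen 8 — §21.18.5)

`0 ≤ J₄(G)` for every rank-`4` set `G ⊆ E` of a simple matroid with at most `9` points, by the trichotomy of
§21.18.1: `g ≤ 7` (`J_four_nonneg_of_card_le_seven`, demand-free), (α) generic (`J_four_nonneg_of_generic_small`,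
the §22.5 certificate at `g = 7, 8, 9`), (β) a plane trace with `g − 1` or `g − 2` points
(`J_four_nonneg_of_plane_add_one`, `J_four_nonneg_of_plane_add_two` — Theorem 21.6), (γ) otherwise every plane trace
has `≤ g − 3` points and `G` is plane-line (`J_four_nonneg_of_planeLine_small`, §21.18.9 via X̄′).  This is the clause
`typeOf M G = 4 → G.card ≤ 9 → 0 ≤ J M G 4` of `SixFourResidue` (`SixFourTransfer.lean`), stated without `typeOf`.
-/

namespace PercRepro.SixFour

open Finset ThmH

variable {α : Type*} [DecidableEq α] {M : Matroid α} [M.Finite] {G : Finset α}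

/-- **The `g ≤ 9` clause at `t = 4`**: `0 ≤ J₄(G)` for every rank-`4` set `G ⊆ E` of a simple matroid with
`|G| ≤ 9`. -/
theorem J_four_nonneg_of_card_le_nine (hs : Simple M) (hG : G ⊆ gr M) (hr : M.eRk (G : Set α) = 4)
    (hg : G.card ≤ 9) : 0 ≤ J M G 4 := by
  by_cases h7 : G.card ≤ 7
  · exact J_four_nonneg_of_card_le_seven h7
  push Not at h7
  by_cases hgen : Generic M G
  · exact J_four_nonneg_of_generic_small hs hG hr hgen (by omega) hg
  by_cases hbig : ∃ P ∈ planes M, G.card ≤ (P ∩ G).card + 2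
  · obtain ⟨P, hP, hPc⟩ := hbig
    have hlt : (P ∩ G).card < G.card := by
      apply Finset.card_lt_card
      refine ⟨Finset.inter_subset_right, fun h => not_subset_plane hr hP ?_⟩
      intro z hz
      exact (Finset.mem_inter.1 (h hz)).1
    rcases (show (P ∩ G).card + 1 = G.card ∨ (P ∩ G).card + 2 = G.card by omega) with h1 | h2
    · exact J_four_nonneg_of_plane_add_one hP h1
    · exact J_four_nonneg_of_plane_add_two hs hG hr hP h2 hg
  · push Not at hbig
    exact J_four_nonneg_of_planeLine_small hs hG hr hgen (fun P hP => by have := hbig P hP; omega) (by omega) hg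

end PercRepro.SixFour
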